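import Summits.QuantumFields.YangMills.Theorems.FluctuationComparisonRegPrIntLWreg
import Literature.MathematicalPhysics.QuantumFieldTheory.Balaban1983to89.T3DescentFibreTower
import Literature.MathematicalPhysics.QuantumFieldTheory.Balaban1983to89.T3OneStepAveragingPlaquettes
import HarnessLib

/-!
# `FluctuationComparisonRegPrIntLOddsLedgerVers` — VERS OF LINE g20-2 «ODDS LEDGER FOR LFR♯ᶜ»: THE FULL DENSITY'S VERSION TERM IS CONSTANT ON THE WINDOW
# (crux `UnitScaleTilt.FluctuationComparisonRegPrIntL`, stmt-QuantumFields-20520; organ LFR♯ᶜ `LargeFieldFourPtCan`; line file `Cruxes/…/Lines/odds_ledger.lean`)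

Cell `ym3-torus` (YM ladder rung R3 = continuum SU(2) Yang–Mills on T³ — a RUNG, NOT the Clay problem: not d = 4, not infinite volume, not a mass gap);
width seat `ym3-torus-px19` (gen 11); helper `--supports stmt-QuantumFields-20520`.  THEOREMS ONLY (0 `def`, 0 `sorry`, default heartbeats).

WHAT.  LINE g20-2 (ideator ym-r3-idea-1 g20) proves LFR♯ᶜ ⟸ VERS ∧ PREG ∧ LEV; **VERS `FullVersionConstCan`** («S∕M, hand-ready») is the trunk bookkeeping row:
for every continuous positive window version `ρ` of the nested law `ν_{K,J}` (a tower `ν K K = Gibbs_K`, `ν K j = (descend j)_* ν K (j+1)`),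
`log ρ − log heightDensityCan^{univ}` is CONSTANT on the window `{PlaqSmall θ_J}`.  This file PROVES that text over the Theorems-side letters
(✓`…WregGlue.heightDensityCan`, definitionally the line file's), so the line closes `stub_fullVersionConstCan := fullVersionConstCan` by `delta`:
* §1 `descend_eq_descendTo` (one descent step IS `D_{K,K+1}`) · ★`tower_eq_map_descendTo` (the tower law at height `J` IS `(D_{J,K})_* Gibbs_K` — induction on
  the depth with ✓`descendTo_descendTo`, ✓`descendTo_self`);
* §2 ★★★`fullVersionConstCan` — ✓`T3TiltDescent.map_descendTo_restrict_eq_withDensity` (at `S = univ`): `(D_{J,K})_* Gibbs_K = dU·(Z_K⁻¹·heightDensity^{univ})`; two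
  `withDensity` presentations of one measure agree a.e. on the (open, hence measurable) window (`withDensity_eq_iff_of_sigmaFinite` on the restricted Haar product,
  where `ρ` is a.e.-measurable by continuity); so `Z_K·ρ` is a CONTINUOUS a.e.-version of `heightDensity^{univ}` on the open window and the canonical version
  EQUALS it there pointwise (✓`Node00.canonVersion_eqOn_of_continuousOn`); hence `log ρ − log heightDensityCan^{univ} = −log Z_K` on the window.
No chart, no WREG threshold: VERS holds for every family, every `γ > 0`, every `J ≤ K` (its `∀`-prefix has no `γ₁`).

HONEST SCOPE.  Measure-theoretic bookkeeping of the trunk; VERS is the S∕M row of the line — PREG, the organ LEV (XL), LFR♯ᶜ, S2β, the crux 20520 and the rung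
`YM3TorusSU2` are NOT proved; no summit statement is proved; the Yang–Mills mass gap is NOT proved.
References: [Balaban1985UV3] (2) p. 256 and (6)–(7) p. 257 (the restricted densities of the averaged Gibbs weight); [Balaban1987RG1] (0.11) p. 253 (one averaging
formula at every level), (0.13) p. 254.
-/

noncomputable section

set_option autoImplicit false

open MeasureTheory Filter Topology Set
open scoped ENNReal NNReal
open Literature.MathematicalPhysics.QuantumFieldTheory.Balaban1983to89
open Literature.MathematicalPhysics.QuantumFieldTheory.Balaban1983to89.T3ContinuumYM3Torus
open Literature.MathematicalPhysics.QuantumFieldTheory.Balaban1983to89.T3NestedUnitLaws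
open Literature.MathematicalPhysics.QuantumFieldTheory.Balaban1983to89.T3UnitLawDensityEML
open Literature.MathematicalPhysics.QuantumFieldTheory.Balaban1983to89.T3UnitScaleTilt
open Literature.MathematicalPhysics.QuantumFieldTheory.Balaban1983to89.T3TiltDescent
open Literature.MathematicalPhysics.QuantumFieldTheory.Balaban1983to89.Missing
open scoped Literature.MathematicalPhysics.QuantumFieldTheory.Balaban1983to89.T3OrbitAverage
open Summit.QuantumFields.YangMills.Theorems.FluctuationComparisonRegPrIntLWregGlue (heightDensityCan)
open Summit.QuantumFields.YangMills.Theorems.FluctuationComparisonRegPrIntLWregAssembly (isOpen_setOf_plaqSmall₂)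

namespace Summit.QuantumFields.YangMills.Theorems.FluctuationComparisonRegPrIntLOddsLedgerVers

/-! ## §1 The tower law at height `J` is the descended Gibbs measure -/

/-- One descent step IS `D_{K,K+1}` (✓`descendTo_succ`; the two `fieldShift` proofs are irrelevant). [cite: Balaban1987RG1, (0.11) p.253] -/
theorem descend_eq_descendTo (F : T3Family) (K : ℕ) (U : GaugeField (F.P (K + 1)) 0 (Matrix.specialUnitaryGroup (Fin 2) ℂ)) :
    descend F ℰp K U = descendTo F ℰp K (K + 1) (Nat.le_succ K) U := by
  rw [T3OneStepAveragingPlaquettes.descendTo_succ]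
  rfl

/-- ★ **THE TOWER LAW AT HEIGHT `J` IS `(D_{J,K})_* Gibbs_K`**: for a tower `ν K K = Gibbs_K`, `ν K j = (descend j)_* ν K (j+1)` (`j < K`) and every `J ≤ K`,
`ν K J = (descendTo J K)_* Gibbs_K`. [cite: Balaban1987RG1, (0.11) p.253] -/
theorem tower_eq_map_descendTo (F : T3Family) (γ : ℝ)
    (ν : ℕ → (j : ℕ) → Measure (GaugeField (F.P j) 0 (Matrix.specialUnitaryGroup (Fin 2) ℂ)))
    (hKK : ∀ K, ν K K = T4GenFunBounds.gibbsMeasure (F.P K) ((F.scheme ℰp γ).β K))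
    (hstep : ∀ K j, j < K → ν K j = Measure.map (descend F ℰp j) (ν K (j + 1)))
    {J K : ℕ} (hJK : J ≤ K) :
    ν K J = Measure.map (descendTo F ℰp J K hJK) (gibbsK F ℰp γ K) := by
  -- induction on the depth `d = K − J`
  suffices h : ∀ d J (hJ : J + d = K), ν K J = Measure.map (descendTo F ℰp J K (by omega)) (gibbsK F ℰp γ K) by
    exact h (K - J) J (by omega)
  intro d
  induction d with
  | zero =>
    intro J hJ
    have hJK' : J = K := by omega
    subst hJK'
    have hid : descendTo F ℰp J J (by omega) = id := funext fun U => T3DescentFibreTower.descendTo_self F ℰp J U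
    rw [hid, Measure.map_id, hKK, gibbsK_eq]
  | succ d ih =>
    intro J hJ
    have hJ1 : J < K := by omega
    rw [hstep K J hJ1, ih (J + 1) (by omega),
      Measure.map_map (measurable_descend F ℰp measurableE_ℰp J) (measurable_descendTo F ℰp measurableE_ℰp _)]
    congr 1
    funext U
    simp only [Function.comp_apply, descend_eq_descendTo]
    exact T3DescentFibreTower.descendTo_descendTo F ℰp _ _ U

/-! ## §2 VERS -/

/-- ★★★ **VERS `FullVersionConstCan` OF LINE g20-2 — THE FULL DENSITY's VERSION TERM IS CONSTANT ON THE WINDOW** (the line's text with its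
`heightDensityCan` read as ✓`…WregGlue.heightDensityCan`; the line closes `stub_fullVersionConstCan` by `delta`): for every continuous positive window version
`ρ` of the nested law `ν_{K,J}`, `log ρ − log heightDensityCan^{univ}` is constant on `{PlaqSmall θ_J}` (namely `= −log Z_K`).
[cite: Balaban1985UV3, (2) p.256 and (6) p.257; Balaban1987RG1, (0.13) p.254] -/
theorem fullVersionConstCan :
    ∀ (F : T3Family) (γ b₀ p₀ : ℝ), 0 < γ →
      ∀ (ν : ℕ → (j : ℕ) → Measure (GaugeField (F.P j) 0 (Matrix.specialUnitaryGroup (Fin 2) ℂ))),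
        (∀ K, ν K K = T4GenFunBounds.gibbsMeasure (F.P K) ((F.scheme ℰp γ).β K)) →
        (∀ K j, j < K → ν K j = Measure.map (descend F ℰp j) (ν K (j + 1))) →
        ∀ (J K : ℕ) (hJK : J ≤ K) (ρ : GaugeField (F.P J) 0 (Matrix.specialUnitaryGroup (Fin 2) ℂ) → ℝ),
          (∀ U, PlaqSmall (θBal F.L γ b₀ p₀ J) U → 0 < ρ U) →
          ν K J = (fieldMeasure _ _ _).withDensity (fun U => ENNReal.ofReal (ρ U)) →
          ContinuousOn ρ {U | PlaqSmall (θBal F.L γ b₀ p₀ J) U} →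
          ∃ c : ℝ, ∀ U : GaugeField (F.P J) 0 (Matrix.specialUnitaryGroup (Fin 2) ℂ), PlaqSmall (θBal F.L γ b₀ p₀ J) U →
            Real.log (ρ U) - Real.log (heightDensityCan F γ hJK Set.univ U) = c := by
  intro F γ b₀ p₀ hγ ν hKK hstep J K hJK ρ hρpos hν hρc
  haveI := B12ContinuousTransportInvariance.isOpenPosMeasure_fieldMeasure_SU (N := 2) (F.P J) 0
  set μ := fieldMeasure (F.P J) 0 (Matrix.specialUnitaryGroup (Fin 2) ℂ) with hμ
  set W : Set (GaugeField (F.P J) 0 (Matrix.specialUnitaryGroup (Fin 2) ℂ)) := {U | PlaqSmall (θBal F.L γ b₀ p₀ J) U} with hW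
  set Z : ℝ := partitionFn (G := Matrix.specialUnitaryGroup (Fin 2) ℂ) (F.P K) ((F.scheme ℰp γ).β K) with hZ
  set hD := heightDensity F γ hJK (Set.univ : Set (GaugeField (F.P K) 0 (Matrix.specialUnitaryGroup (Fin 2) ℂ))) with hhD
  have hZpos : 0 < Z := partitionFn_pos' _ (F.scheme_β_nonneg ℰp hγ.le K)
  have hWo : IsOpen W := isOpen_setOf_plaqSmall₂ (F.P J) 0 _
  have hWm : MeasurableSet W := hWo.measurableSet
  obtain ⟨hDm, hDi⟩ := heightDensity_props F hJK (S := (Set.univ : Set (GaugeField (F.P K) 0 (Matrix.specialUnitaryGroup (Fin 2) ℂ))))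
    MeasurableSet.univ hγ.le
  -- the two presentations of `ν K J`
  have h1 : ν K J = μ.withDensity (fun U => ENNReal.ofReal (Z⁻¹ * hD U)) := by
    rw [tower_eq_map_descendTo F γ ν hKK hstep hJK, ← Measure.restrict_univ (μ := gibbsK F ℰp γ K)]
    exact map_descendTo_restrict_eq_withDensity F hJK MeasurableSet.univ hγ.le
  have h2 : (μ.restrict W).withDensity (fun U => ENNReal.ofReal (ρ U)) = (μ.restrict W).withDensity (fun U => ENNReal.ofReal (Z⁻¹ * hD U)) := by
    rw [← restrict_withDensity hWm, ← restrict_withDensity hWm, ← hν, h1]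
  -- a.e. equality on the window
  have hρm : AEMeasurable (fun U => ENNReal.ofReal (ρ U)) (μ.restrict W) := (hρc.aemeasurable hWm).ennreal_ofReal
  have hgm : AEMeasurable (fun U => ENNReal.ofReal (Z⁻¹ * hD U)) (μ.restrict W) := (hDm.const_mul _).ennreal_ofReal.aemeasurable
  have hae : (fun U => ENNReal.ofReal (ρ U)) =ᵐ[μ.restrict W] fun U => ENNReal.ofReal (Z⁻¹ * hD U) :=
    (withDensity_eq_iff_of_sigmaFinite hρm hgm).mp h2
  have hae' : (fun U => Z * ρ U) =ᵐ[μ.restrict W] hD := by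
    filter_upwards [hae, ae_restrict_mem hWm] with U hU hUW
    have hρ0 : 0 ≤ ρ U := (hρpos U hUW).le
    have hg0 : 0 ≤ Z⁻¹ * hD U := mul_nonneg (inv_nonneg.mpr hZpos.le) (heightDensity_nonneg F γ hJK _ U)
    have := (ENNReal.ofReal_eq_ofReal_iff hρ0 hg0).mp hU
    rw [this, ← mul_assoc, mul_inv_cancel₀ hZpos.ne', one_mul]
  -- the canonical version equals the continuous version `Z·ρ` on the open window
  have hcont : ContinuousOn (fun U => Z * ρ U) W := continuousOn_const.mul hρc
  have hEq : EqOn (heightDensityCan F γ hJK Set.univ) (fun U => Z * ρ U) W :=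
    Node00.canonVersion_eqOn_of_continuousOn hWo hcont hae'
  refine ⟨-Real.log Z, fun U hU => ?_⟩
  have hρU := hρpos U hU
  rw [hEq hU, Real.log_mul hZpos.ne' hρU.ne']
  ring

end Summit.QuantumFields.YangMills.Theorems.FluctuationComparisonRegPrIntLOddsLedgerVers

end
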